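import Literature.NumberTheory.GaloisRepresentations.LubinTateColemanTwoVariableTransformCyclicTwo
import HarnessLib

/-!
# The two-variable Coleman transform along a general unramified tower under ALL of `Γ_F`:
# `Col(σ̃·β)_j = (1 + D^{𝒪⟦X⟧}_{χ(σ̃)})(C(g_{σ̃})·Col(β)_{j − s_{σ̃}})` with `(g_{σ̃}, s_{σ̃}) ∈ 𝒪_F⟦X⟧ × ℤ/d` the Amice pair of `σ̃|_{E_∞} ∈ ℤ_p × ℤ/d`

De Shalit, *Iwasawa theory of elliptic curves with complex multiplication* (1987), Ch. I §3.1 (`ℤ_p⟦𝒢⟧ = Λ[Δ]`), §3.4 (Lemma (ii) and the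
extension of `i` to `𝒢`), §3.8 (16)–(17), Ch. III §1.3: Coleman's map is a homomorphism over the completed group ring of the WHOLE Galois
group of the two-variable local tower.  `LubinTateColemanTwoVariableTwistGaloisTwo` did this for `ℤ_p`-towers; here the unramified tower is
`[E_m : F] = d·p^m` with `p ∤ d` (`LubinTateColemanTwoVariableTransformCyclicTwo`), so that `Gal(E_∞/F) ≅ ℤ/d × ℤ_p` and the transform
is `ℤ/d`-indexed.  On each layer `σ̃|_{E_m} = σ₀^{a_m}|_{E_m}` with `a_{m+1} ≡ a_m (mod dp^m)`: the residues `a_m mod d` are CONSTANT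
(`=: s_{σ̃} ∈ ℤ/d`) and the powers `(1+X)^{a_m}` converge to the Amice element `g_{σ̃} ∈ 𝒪_F⟦X⟧`:

* ★★ `isColemanTransformProd₂_galAct_general` — for ANY `σ̃ ∈ Γ_F`: if `G` is a transform of the coefficient-twisted family
  `((r_{β_m})^{σ̃|E_m})_m` then `j ↦ G j + D^{𝒪⟦X⟧}_{χ(σ̃)}(G j)` is a transform of `(σ̃·β_m)_m` (Lemma 3.4 (ii) levelwise,
  `relUnitCoordTwo_galAct_eq`, and the congruences pass through the twist, `dvd_coeff_twistLinearBase_sub_sum`);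
* ★★ `exists_amicePair_galois` — **the Amice pair `(g, s)` of `σ̃|_{E_∞}`**: `ω_m ∣ g − (1+X)^{a_m}` and `a_m ≡ s (mod d)` with
  `σ̃|_{E_m} = σ₀^{a_m}|_{E_m}` for all `m`; `amicePair_galois_of_forall_smul_eq` (`(1, 0)` for `σ̃` fixing `E_∞`), `amicePair_galois_frob`
  (`(1 + X, 1)` for `σ₀`), ★ `amicePair_galois_mul` (**multiplicativity**: `(g g', s + s')` for `σ̃τ̃`);
* ★★ `seriesProd_amice_galois` — **`j ↦ C(g)·G(j − s)` is a transform of the coefficient-twisted family `((r_m)^{σ̃|E_m})_m`**;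
* ★★★ `isColemanTransformProd₂_galois` / `colemanTransformProd₂_galois_eq` — **`Col(σ̃·β)_j = (1 + D^{𝒪⟦X⟧}_{χ(σ̃)})(C(g_{σ̃})·Col(β)_{j − s_{σ̃}})`
  for EVERY `σ̃ ∈ Γ_F`**: the transform intertwines the Galois group of the two-variable local tower with the
  `Λ(ℤ/d × ℤ_p × Γ') = 𝒪_F[ℤ/d]⟦X⟧⟦T⟧`-structure of `𝒪_F[ℤ/d]⟦X⟧⟦Y⟧` (`σ̃ ↦ ([s_{σ̃}]·g_{σ̃}, 1 + D_{χ(σ̃)})`).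

Everything PROVED (0 sorry, no named facts, no new definitions).

## References

* E. de Shalit, *Iwasawa theory of elliptic curves with complex multiplication* (1987), Ch. I §3.1, §3.4, §3.8 (16)–(17); Ch. III §1.3. [deShalit1987]
* L. C. Washington, *Introduction to Cyclotomic Fields*, 2nd ed. (1997), §7.1. [Washington1997]
-/

noncomputable section

open scoped PowerSeries.WithPiTopology

namespace Literature.NumberTheory.GaloisRepresentations

section TwoVariableGaloisCyclicTwo

open GaloisRepresentations.IsNonarchimedeanLocalField LubinTate ValuativeRel Field Finset
open Literature.NumberTheory.EllipticCurves.IwasawaOmega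

variable {F : Type} [Field F] [ValuativeRel F] [TopologicalSpace F] [IsNonarchimedeanLocalField F]

attribute [local instance] ltNormUniformSpace ltNormIsUniformAddGroup rk1 nF nE fintypeResidueField

variable (p : ℕ) [hp : Fact p.Prime] (d : ℕ) [NeZero d] (hd : d.Coprime p)
variable {π : 𝒪[F]} (hπ : (valuation F).IsUniformizer (π : F)) (hq : residueFieldCard F = 2)
variable (E : ℕ → IntermediateField F (AlgebraicClosure F)) [∀ m, FiniteDimensional F (E m)] [∀ m, Normal F (E m)]
  [∀ m, IsGalois F (E m)] (hmono : Monotone E) (hE : ∀ m, E m ≤ maxUnramified F) (hdeg : ∀ m, Module.finrank F (E m) = d * p ^ m)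
  {σ₀ : absoluteGaloisGroup F} (hσ₀ : IsAbsArithFrob σ₀)

/-! ### The Lubin–Tate twist of an arbitrary `σ̃`, componentwise -/

omit [NeZero d] in
/-- ★★ **Any `σ̃ ∈ Γ_F`: if `G` is a transform of the coefficient-twisted family `((r_{β_m})^{σ̃|E_m})_m`, then
`j ↦ G j + D^{𝒪⟦X⟧}_{χ(σ̃)}(G j)` is a transform of `(σ̃·β_m)_m`** (levelwise `r_{σ̃β_m} = (1 + D^{𝒪_{E_m}}_{χ(σ̃)})((r_{β_m})^{σ̃|E_m})` by
`relUnitCoordTwo_galAct_eq`; the congruences pass through the twist by `dvd_coeff_twistLinearBase_sub_sum` with the index family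
`i ↦ φ_m^{χ_m⁻¹(j,i)}`). [cite: deShalit1987, Ch. I §3.4 Lemma (ii), §3.8 (16)–(17)] -/
theorem isColemanTransformProd₂_galAct_general {θ : ∀ m, unitBall (E m)} (hθ : ∀ m, IsIntegralNormalGen (E m) (θ m)) (u : (LTCoeff F)ˣ)
    (hu : LTCoeff.of F π = residueFieldCard F * u) (β : ∀ m, RelNormCoherentUnits hπ (E m)) (σ : absoluteGaloisGroup F)
    {G : ZMod d → PowerSeries (PowerSeries 𝒪[F])}
    (hG : ∀ m k (j : ZMod d), ((1 + PowerSeries.X : PowerSeries 𝒪[F]) ^ p ^ m - 1) ∣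
      PowerSeries.coeff k (G j) - ∑ i : ZMod (p ^ m), PowerSeries.C ((hθ m).basis.repr
        (PowerSeries.coeff k (PowerSeries.map (frobUnitBall (E m) σ : unitBall (E m) →+* unitBall (E m))
          (relUnitCoordTwo hπ (E m) hq (hE m) hσ₀ u hu (β m))))
        (((absoluteGaloisGroup.toAlgEquiv F σ₀).restrictNormal (E m)) ^ ((ZMod.chineseRemainder (hd.pow_right m)).symm (j, i)).val)) *
          (1 + PowerSeries.X) ^ i.val) (m k : ℕ) (j : ZMod d) :
    ((1 + PowerSeries.X : PowerSeries 𝒪[F]) ^ p ^ m - 1) ∣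
      PowerSeries.coeff k (G j + twistLinearBase hπ hq ((PowerSeries.C (R := 𝒪[F])).comp (LTCoeff.of F).symm.toRingHom) u
        (lubinTateChar hπ σ) (G j)) - ∑ i : ZMod (p ^ m), PowerSeries.C ((hθ m).basis.repr
        (PowerSeries.coeff k (relUnitCoordTwo hπ (E m) hq (hE m) hσ₀ u hu ((β m).galAct σ)))
        (((absoluteGaloisGroup.toAlgEquiv F σ₀).restrictNormal (E m)) ^ ((ZMod.chineseRemainder (hd.pow_right m)).symm (j, i)).val)) *
          (1 + PowerSeries.X) ^ i.val := by
  set x := PowerSeries.map (frobUnitBall (E m) σ : unitBall (E m) →+* unitBall (E m)) (relUnitCoordTwo hπ (E m) hq (hE m) hσ₀ u hu (β m))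
    with hx
  -- levelwise: `r_{σ̃β_m} = x + D^{𝒪_{E_m}} x`
  have hlev : relUnitCoordTwo hπ (E m) hq (hE m) hσ₀ u hu ((β m).galAct σ) =
      x + twistLinearBase hπ hq (algebraMap (LTCoeff F) (unitBall (E m))) u (lubinTateChar hπ σ) x := by
    rw [relUnitCoordTwo_galAct_eq hπ (E m) hq (hE m) hσ₀ u hu (β m) σ, twistLinearBase_apply, add_sub_cancel, hx]
    rfl
  rw [hlev, map_add, map_add]
  have e : ∀ (a b c d : PowerSeries 𝒪[F]), a + b - (c + d) = (a - c) + (b - d) := fun a b c d => by ring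
  have hsum : ∑ i : ZMod (p ^ m), PowerSeries.C ((hθ m).basis.repr (PowerSeries.coeff k x + PowerSeries.coeff k
          (twistLinearBase hπ hq (algebraMap (LTCoeff F) (unitBall (E m))) u (lubinTateChar hπ σ) x))
        (((absoluteGaloisGroup.toAlgEquiv F σ₀).restrictNormal (E m)) ^ ((ZMod.chineseRemainder (hd.pow_right m)).symm (j, i)).val)) *
          (1 + PowerSeries.X) ^ i.val =
      ∑ i : ZMod (p ^ m), PowerSeries.C ((hθ m).basis.repr (PowerSeries.coeff k x)
        (((absoluteGaloisGroup.toAlgEquiv F σ₀).restrictNormal (E m)) ^ ((ZMod.chineseRemainder (hd.pow_right m)).symm (j, i)).val)) *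
          (1 + PowerSeries.X) ^ i.val +
      ∑ i : ZMod (p ^ m), PowerSeries.C ((hθ m).basis.repr (PowerSeries.coeff k
          (twistLinearBase hπ hq (algebraMap (LTCoeff F) (unitBall (E m))) u (lubinTateChar hπ σ) x))
        (((absoluteGaloisGroup.toAlgEquiv F σ₀).restrictNormal (E m)) ^ ((ZMod.chineseRemainder (hd.pow_right m)).symm (j, i)).val)) *
          (1 + PowerSeries.X) ^ i.val := by
    rw [← sum_add_distrib]
    refine sum_congr rfl fun i _ => ?_
    rw [map_add, Finsupp.add_apply, map_add, add_mul]
  rw [hsum, e]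
  exact dvd_add (hG m k j) (dvd_coeff_twistLinearBase_sub_sum hπ hq (hθ m) Finset.univ
    (fun i : ZMod (p ^ m) => ((absoluteGaloisGroup.toAlgEquiv F σ₀).restrictNormal (E m)) ^
      ((ZMod.chineseRemainder (hd.pow_right m)).symm (j, i)).val) _ _ u (lubinTateChar hπ σ) (fun k' => hG m k' j) k)

/-! ### The Amice pair `(g_{σ̃}, s_{σ̃}) ∈ 𝒪_F⟦X⟧ × ℤ/d` of `σ̃|_{E_∞} ∈ Gal(E_∞/F) ≅ ℤ_p × ℤ/d` -/

omit hp [NeZero d] in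
include hmono hE hdeg hσ₀ in
/-- ★★ **The Amice pair of `σ̃|_{E_∞}`**: for every `σ̃ ∈ Γ_F` there are `g ∈ 𝒪_F⟦X⟧` and `s ∈ ℤ/d` such that for every `m`, with
`σ̃|_{E_m} = σ₀^{a}|_{E_m}`: `ω_m ∣ g − (1+X)^{a}` and `a ≡ s (mod d)` (the exponents are compatible modulo `dp^m`, so their residues
mod `d` are constant and `((1+X)^{a_m})_m` converges in `lim← 𝒪_F⟦X⟧/(ω_m) = 𝒪_F⟦X⟧`). [cite: deShalit1987, Ch. I §3.1] -/
theorem exists_amicePair_galois [IsAdicComplete (Ideal.span {(p : 𝒪[F])}) 𝒪[F]] (σ : absoluteGaloisGroup F) :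
    ∃ (g : PowerSeries 𝒪[F]) (s : ZMod d), ∀ m, ∃ a : ℕ, (∀ x : E m, σ • (x : AlgebraicClosure F) = (σ₀ ^ a) • (x : AlgebraicClosure F)) ∧
      ((1 + PowerSeries.X : PowerSeries 𝒪[F]) ^ p ^ m - 1) ∣ g - (1 + PowerSeries.X) ^ a ∧ (a : ZMod d) = s := by
  have hex := fun m => exists_forall_smul_eq_pow_smul (E m) (hE m) hσ₀ σ
  choose a ha using hex
  -- compatibility of the exponents modulo `d·p^m`
  have hcompat : ∀ m, a (m + 1) ≡ a m [MOD d * p ^ m] := fun m => by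
    rw [← hdeg m]
    refine modEq_of_forall_smul_eq (E m) (hE m) hσ₀ fun x => ?_
    have h1 : σ • (x : AlgebraicClosure F) = (σ₀ ^ a (m + 1)) • (x : AlgebraicClosure F) :=
      ha (m + 1) ⟨(x : AlgebraicClosure F), hmono (Nat.le_succ m) x.2⟩
    exact h1.symm.trans (ha m x)
  -- the `ℤ/d`-component is constant
  have hmodd : ∀ m, (a m : ZMod d) = (a 0 : ZMod d) := by
    intro m
    induction m with
    | zero => rfl
    | succ m ih => rw [← ih]; exact (ZMod.natCast_eq_natCast_iff _ _ _).mpr ((hcompat m).of_mul_right (p ^ m))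
  obtain ⟨g, hg⟩ := exists_forall_omega_dvd_sub p (fun m => (1 + PowerSeries.X : PowerSeries 𝒪[F]) ^ a m) fun m =>
    omega_dvd_pow_sub_pow_of_modEq p ((hcompat m).of_mul_left d)
  exact ⟨g, (a 0 : ZMod d), fun m => ⟨a m, ha m, hg m, hmodd m⟩⟩

omit [TopologicalSpace F] [IsNonarchimedeanLocalField F] [∀ m, FiniteDimensional F (E m)] [∀ m, Normal F (E m)]
  [∀ m, IsGalois F (E m)] hp [NeZero d] in
/-- **`(1, 0)` is the Amice pair of any `σ̃` fixing every `E_m`** (exponent `0` at every level). [cite: deShalit1987, Ch. I §3.1] -/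
theorem amicePair_galois_of_forall_smul_eq {σ₀' σ : absoluteGaloisGroup F} (hσE : ∀ m (x : E m), σ • (x : AlgebraicClosure F) = x)
    (m : ℕ) :
    ∃ a : ℕ, (∀ x : E m, σ • (x : AlgebraicClosure F) = (σ₀' ^ a) • (x : AlgebraicClosure F)) ∧
      ((1 + PowerSeries.X : PowerSeries 𝒪[F]) ^ p ^ m - 1) ∣ (1 : PowerSeries 𝒪[F]) - (1 + PowerSeries.X) ^ a ∧ (a : ZMod d) = 0 :=
  ⟨0, fun x => by rw [pow_zero, one_smul, hσE], by rw [pow_zero, sub_self]; exact dvd_zero _, Nat.cast_zero⟩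

omit [TopologicalSpace F] [IsNonarchimedeanLocalField F] [∀ m, FiniteDimensional F (E m)] [∀ m, Normal F (E m)]
  [∀ m, IsGalois F (E m)] hp [NeZero d] in
/-- **`(1 + X, 1)` is the Amice pair of the Frobenius `σ₀`** (exponent `1` at every level). [cite: deShalit1987, Ch. I §3.1] -/
theorem amicePair_galois_frob (σ₀' : absoluteGaloisGroup F) (m : ℕ) :
    ∃ a : ℕ, (∀ x : E m, σ₀' • (x : AlgebraicClosure F) = (σ₀' ^ a) • (x : AlgebraicClosure F)) ∧
      ((1 + PowerSeries.X : PowerSeries 𝒪[F]) ^ p ^ m - 1) ∣ (1 + PowerSeries.X : PowerSeries 𝒪[F]) - (1 + PowerSeries.X) ^ a ∧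
        (a : ZMod d) = 1 :=
  ⟨1, fun x => by rw [pow_one], by rw [pow_one, sub_self]; exact dvd_zero _, Nat.cast_one⟩

omit [TopologicalSpace F] [IsNonarchimedeanLocalField F] [∀ m, FiniteDimensional F (E m)] [∀ m, IsGalois F (E m)] hp [NeZero d] in
/-- ★ **The Amice pairs are multiplicative**: if `(g, s)` is an Amice pair of `σ̃` and `(g', s')` one of `τ̃`, then `(g·g', s + s')` is one of
`σ̃τ̃` (exponents add levelwise; `amice_galois_mul` plus the residues mod `d`). [cite: deShalit1987, Ch. I §3.1] -/
theorem amicePair_galois_mul {σ₀' σ τ : absoluteGaloisGroup F} {g g' : PowerSeries 𝒪[F]} {s s' : ZMod d}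
    (hg : ∀ m, ∃ a : ℕ, (∀ x : E m, σ • (x : AlgebraicClosure F) = (σ₀' ^ a) • (x : AlgebraicClosure F)) ∧
      ((1 + PowerSeries.X : PowerSeries 𝒪[F]) ^ p ^ m - 1) ∣ g - (1 + PowerSeries.X) ^ a ∧ (a : ZMod d) = s)
    (hg' : ∀ m, ∃ a : ℕ, (∀ x : E m, τ • (x : AlgebraicClosure F) = (σ₀' ^ a) • (x : AlgebraicClosure F)) ∧
      ((1 + PowerSeries.X : PowerSeries 𝒪[F]) ^ p ^ m - 1) ∣ g' - (1 + PowerSeries.X) ^ a ∧ (a : ZMod d) = s') (m : ℕ) :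
    ∃ a : ℕ, (∀ x : E m, (σ * τ) • (x : AlgebraicClosure F) = (σ₀' ^ a) • (x : AlgebraicClosure F)) ∧
      ((1 + PowerSeries.X : PowerSeries 𝒪[F]) ^ p ^ m - 1) ∣ g * g' - (1 + PowerSeries.X) ^ a ∧ (a : ZMod d) = s + s' := by
  obtain ⟨a, ha, hga, has⟩ := hg m
  obtain ⟨b, hb, hgb, hbs⟩ := hg' m
  obtain ⟨c, hc, hgc⟩ := amice_galois_mul p E (σ₀' := σ₀') (σ := σ) (τ := τ) (g := g) (g' := g')
    (fun m' => by obtain ⟨a', ha', hga', -⟩ := hg m'; exact ⟨a', ha', hga'⟩)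
    (fun m' => by obtain ⟨b', hb', hgb', -⟩ := hg' m'; exact ⟨b', hb', hgb'⟩) m
  -- recompute with the explicit exponent `a + b` (as in `amice_galois_mul`) to read off the residue mod `d`
  refine ⟨a + b, fun x => ?_, ?_, by rw [Nat.cast_add, has, hbs]⟩
  · have hmem : (σ₀' ^ b) • (x : AlgebraicClosure F) =
        ((((absoluteGaloisGroup.toAlgEquiv F (σ₀' ^ b)).restrictNormal (E m)) x : E m) : AlgebraicClosure F) :=
      (coe_restrictNormal_apply (E m) (σ₀' ^ b) x).symm
    rw [mul_smul, hb, hmem, ha, ← hmem, ← mul_smul, ← pow_add]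
  · have e : g * g' - (1 + PowerSeries.X) ^ (a + b) = g * (g' - (1 + PowerSeries.X) ^ b) + (1 + PowerSeries.X) ^ b * (g - (1 + PowerSeries.X) ^ a) := by
      rw [pow_add]; ring
    rw [e]
    exact dvd_add (Dvd.dvd.mul_left hgb _) (Dvd.dvd.mul_left hga _)

/-! ### Transforms of Galois-twisted coefficient families -/

include hE hdeg hσ₀ in
/-- ★★ **`j ↦ C(g)·G(j − s)` is a transform of the coefficient-twisted family `((r_m)^{σ̃|E_m})_m`** for the Amice pair `(g, s)` of `σ̃`
(`seriesProd_amice_frobPow` at the exponent `a_m`, then `ω_m ∣ g − (1+X)^{a_m}` and `a_m ≡ s (mod d)`). [cite: deShalit1987, Ch. I §3.1, §3.8 (17)] -/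
theorem seriesProd_amice_galois {θ : ∀ m, unitBall (E m)} (hθ : ∀ m, IsIntegralNormalGen (E m) (θ m))
    (r : ∀ m, PowerSeries (unitBall (E m))) (G : ZMod d → PowerSeries (PowerSeries 𝒪[F]))
    (hG : ∀ m k (j : ZMod d), ((1 + PowerSeries.X : PowerSeries 𝒪[F]) ^ p ^ m - 1) ∣
      PowerSeries.coeff k (G j) - ∑ i : ZMod (p ^ m), PowerSeries.C ((hθ m).basis.repr (PowerSeries.coeff k (r m))
        (((absoluteGaloisGroup.toAlgEquiv F σ₀).restrictNormal (E m)) ^ ((ZMod.chineseRemainder (hd.pow_right m)).symm (j, i)).val)) *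
          (1 + PowerSeries.X) ^ i.val)
    (σ : absoluteGaloisGroup F) {g : PowerSeries 𝒪[F]} {s : ZMod d}
    (hg : ∀ m, ∃ a : ℕ, (∀ x : E m, σ • (x : AlgebraicClosure F) = (σ₀ ^ a) • (x : AlgebraicClosure F)) ∧
      ((1 + PowerSeries.X : PowerSeries 𝒪[F]) ^ p ^ m - 1) ∣ g - (1 + PowerSeries.X) ^ a ∧ (a : ZMod d) = s) (m k : ℕ) (j : ZMod d) :
    ((1 + PowerSeries.X : PowerSeries 𝒪[F]) ^ p ^ m - 1) ∣
      PowerSeries.coeff k (PowerSeries.C g * G (j - s)) - ∑ i : ZMod (p ^ m), PowerSeries.C ((hθ m).basis.repr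
        (PowerSeries.coeff k (PowerSeries.map (frobUnitBall (E m) σ : unitBall (E m) →+* unitBall (E m)) (r m)))
        (((absoluteGaloisGroup.toAlgEquiv F σ₀).restrictNormal (E m)) ^ ((ZMod.chineseRemainder (hd.pow_right m)).symm (j, i)).val)) *
          (1 + PowerSeries.X) ^ i.val := by
  obtain ⟨a, ha, hga, has⟩ := hg m
  have h := seriesProd_amice_frobPow p d hd E hE hdeg hσ₀ hθ r G hG a m k j
  rw [← frobUnitBall_eq_pow_of_forall_smul_eq (E m) ha, has] at h
  have e : PowerSeries.coeff k (PowerSeries.C g * G (j - s)) =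
      PowerSeries.coeff k (PowerSeries.C ((1 + PowerSeries.X : PowerSeries 𝒪[F]) ^ a) * G (j - s)) +
        (g - (1 + PowerSeries.X) ^ a) * PowerSeries.coeff k (G (j - s)) := by
    rw [PowerSeries.coeff_C_mul, PowerSeries.coeff_C_mul]; ring
  rw [e, add_sub_right_comm]
  exact dvd_add h (Dvd.dvd.mul_right hga _)

include hE hdeg hσ₀ in
/-- ★★★ **If `G` is a transform of `β` and `(g, s)` the Amice pair of `σ̃`, then `j ↦ (1 + D^{𝒪⟦X⟧}_{χ(σ̃)})(C(g)·G(j − s))` is a transform of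
`(σ̃·β_m)_m`** (congruence form; no completeness needed beyond the existence of `g`). [cite: deShalit1987, Ch. I §3.4, §3.8 (16)–(17); Ch. III §1.3] -/
theorem isColemanTransformProd₂_galois {θ : ∀ m, unitBall (E m)} (hθ : ∀ m, IsIntegralNormalGen (E m) (θ m)) (u : (LTCoeff F)ˣ)
    (hu : LTCoeff.of F π = residueFieldCard F * u) (β : ∀ m, RelNormCoherentUnits hπ (E m)) (σ : absoluteGaloisGroup F)
    {g : PowerSeries 𝒪[F]} {s : ZMod d}
    (hg : ∀ m, ∃ a : ℕ, (∀ x : E m, σ • (x : AlgebraicClosure F) = (σ₀ ^ a) • (x : AlgebraicClosure F)) ∧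
      ((1 + PowerSeries.X : PowerSeries 𝒪[F]) ^ p ^ m - 1) ∣ g - (1 + PowerSeries.X) ^ a ∧ (a : ZMod d) = s)
    {G : ZMod d → PowerSeries (PowerSeries 𝒪[F])}
    (hG : ∀ m k (j : ZMod d), ((1 + PowerSeries.X : PowerSeries 𝒪[F]) ^ p ^ m - 1) ∣
      PowerSeries.coeff k (G j) - ∑ i : ZMod (p ^ m), PowerSeries.C ((hθ m).basis.repr
        (PowerSeries.coeff k (relUnitCoordTwo hπ (E m) hq (hE m) hσ₀ u hu (β m)))
        (((absoluteGaloisGroup.toAlgEquiv F σ₀).restrictNormal (E m)) ^ ((ZMod.chineseRemainder (hd.pow_right m)).symm (j, i)).val)) *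
          (1 + PowerSeries.X) ^ i.val) (m k : ℕ) (j : ZMod d) :
    ((1 + PowerSeries.X : PowerSeries 𝒪[F]) ^ p ^ m - 1) ∣
      PowerSeries.coeff k (PowerSeries.C g * G (j - s) + twistLinearBase hπ hq ((PowerSeries.C (R := 𝒪[F])).comp (LTCoeff.of F).symm.toRingHom) u
        (lubinTateChar hπ σ) (PowerSeries.C g * G (j - s))) - ∑ i : ZMod (p ^ m), PowerSeries.C ((hθ m).basis.repr
        (PowerSeries.coeff k (relUnitCoordTwo hπ (E m) hq (hE m) hσ₀ u hu ((β m).galAct σ)))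
        (((absoluteGaloisGroup.toAlgEquiv F σ₀).restrictNormal (E m)) ^ ((ZMod.chineseRemainder (hd.pow_right m)).symm (j, i)).val)) *
          (1 + PowerSeries.X) ^ i.val :=
  isColemanTransformProd₂_galAct_general p d hd hπ hq E hE hσ₀ hθ u hu β σ (G := fun j' => PowerSeries.C g * G (j' - s))
    (fun m' k' j' => seriesProd_amice_galois p d hd E hE hdeg hσ₀ hθ (fun n => relUnitCoordTwo hπ (E n) hq (hE n) hσ₀ u hu (β n)) G hG σ hg
      m' k' j') m k j

include hdeg in
/-- ★★★ **`Col(σ̃·β)_j = (1 + D^{𝒪⟦X⟧}_{χ(σ̃)})(C(g_{σ̃})·Col(β)_{j − s_{σ̃}})` for EVERY `σ̃ ∈ Γ_F`**: if `G` is the transform of a baseNorm-coherent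
family `β`, `G'` the transform of `(σ̃·β_m)_m`, and `(g, s)` the Amice pair of `σ̃|_{E_∞}` (`exists_amicePair_galois`), then
`G' j = C(g)·G(j − s) + D_{χ(σ̃)}(C(g)·G(j − s))`: the two-variable Coleman transform intertwines the whole Galois group of the two-variable
local tower with the `𝒪_F[ℤ/d]⟦X⟧⟦T⟧ = Λ(ℤ/d × ℤ_p × Γ')`-structure of `𝒪_F[ℤ/d]⟦X⟧⟦Y⟧` (`σ̃ ↦ ([s_{σ̃}]·g_{σ̃}, 1 + D_{χ(σ̃)})`).
Special cases: `(1, 0)` for `σ̃` fixing `E_∞` (`amicePair_galois_of_forall_smul_eq`), `(1 + X, 1)` for `σ₀` (`amicePair_galois_frob`).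
[cite: deShalit1987, Ch. I §3.1, §3.4, §3.8 (17); Ch. III §1.3] -/
theorem colemanTransformProd₂_galois_eq [IsAdicComplete (Ideal.span {(p : 𝒪[F])}) 𝒪[F]] {θ : ∀ m, unitBall (E m)}
    (hθ : ∀ m, IsIntegralNormalGen (E m) (θ m)) (hcoh : ∀ m, unitBallTrace (hmono (Nat.le_succ m)) (θ (m + 1)) = θ m)
    (u : (LTCoeff F)ˣ) (hu : LTCoeff.of F π = residueFieldCard F * u) {β : ∀ m, RelNormCoherentUnits hπ (E m)}
    (hβ : ∀ m, (β (m + 1)).baseNorm hπ (hmono (Nat.le_succ m)) = β m) (σ : absoluteGaloisGroup F) {g : PowerSeries 𝒪[F]} {s : ZMod d}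
    (hg : ∀ m, ∃ a : ℕ, (∀ x : E m, σ • (x : AlgebraicClosure F) = (σ₀ ^ a) • (x : AlgebraicClosure F)) ∧
      ((1 + PowerSeries.X : PowerSeries 𝒪[F]) ^ p ^ m - 1) ∣ g - (1 + PowerSeries.X) ^ a ∧ (a : ZMod d) = s)
    {G G' : ZMod d → PowerSeries (PowerSeries 𝒪[F])}
    (hG : ∀ m k (j : ZMod d), ((1 + PowerSeries.X : PowerSeries 𝒪[F]) ^ p ^ m - 1) ∣
      PowerSeries.coeff k (G j) - ∑ i : ZMod (p ^ m), PowerSeries.C ((hθ m).basis.repr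
        (PowerSeries.coeff k (relUnitCoordTwo hπ (E m) hq (hE m) hσ₀ u hu (β m)))
        (((absoluteGaloisGroup.toAlgEquiv F σ₀).restrictNormal (E m)) ^ ((ZMod.chineseRemainder (hd.pow_right m)).symm (j, i)).val)) *
          (1 + PowerSeries.X) ^ i.val)
    (hG' : ∀ m k (j : ZMod d), ((1 + PowerSeries.X : PowerSeries 𝒪[F]) ^ p ^ m - 1) ∣
      PowerSeries.coeff k (G' j) - ∑ i : ZMod (p ^ m), PowerSeries.C ((hθ m).basis.repr
        (PowerSeries.coeff k (relUnitCoordTwo hπ (E m) hq (hE m) hσ₀ u hu ((β m).galAct σ)))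
        (((absoluteGaloisGroup.toAlgEquiv F σ₀).restrictNormal (E m)) ^ ((ZMod.chineseRemainder (hd.pow_right m)).symm (j, i)).val)) *
          (1 + PowerSeries.X) ^ i.val) (j : ZMod d) :
    G' j = PowerSeries.C g * G (j - s) + twistLinearBase hπ hq ((PowerSeries.C (R := 𝒪[F])).comp (LTCoeff.of F).symm.toRingHom) u
      (lubinTateChar hπ σ) (PowerSeries.C g * G (j - s)) :=
  congrFun ((existsUnique_colemanTransformProd₂ p d hd hπ E hmono hE hdeg hσ₀ hq hθ hcoh u hu (galAct_baseNormCoherent hπ E hmono σ hβ)).unique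
    hG' (isColemanTransformProd₂_galois p d hd hπ hq E hE hdeg hσ₀ hθ u hu β σ hg hG)) j

end TwoVariableGaloisCyclicTwo

end Literature.NumberTheory.GaloisRepresentations
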